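import Literature.NumberTheory.IwasawaTheory.ImaginaryQuadraticTwoTowerDyadicGrowthLowerBound
import Literature.NumberTheory.NumberFields.OneRamifiedPrimeTower
import HarnessLib

/-!
# The dyadic class in the layers of the cyclotomic `ℤ₂`-tower of `ℚ(√−d)`, `d ≡ 1 (mod 4)` — transported to the layers of `κ|_K`

Topic `NumberTheory/IwasawaTheory`; namespace `Literature.NumberTheory.IwasawaTheory`.  Theorem-only file (no definition, no
named fact, no `sorry`), unconditional.

`K ∋ √−d` a number field of degree `2`, `d ≡ 1 (mod 4)` squarefree, `d ≠ 1`; `κ₀ = (ℚ_∞)|_K` the cyclotomic `ℤ₂`-extension of `K` obtained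
by restriction (`(CyclotomicZp.zpExtension 2).restrict K h`), `K_m = κ₀.layer m` its layers, `𝔓_m` the unique prime of `K_m` above `2`
(tree `exists_dyadic_prime_layer`), `c_m = [𝔓_m] ∈ Cl(K_m)`.  The companion files `ImaginaryQuadraticTwoTowerDyadicPrime`,
`…DyadicCapitulation` prove the facts below for the model `X_m = e(K)·ℚ_m ⊆ ℚ̄`; here they are transported along the isomorphisms
`X_m ≅ K_m` (tree `exists_ringEquiv_fieldRange_sup_layer_apply`, `exists_ringEquiv_fieldRange_sup_layer_pair`) and complemented by
the norm and Galois behaviour of `c_m`, so that all of them are available for the layers of ONE `ℤ₂`-extension `κ₀` with its generic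
layer API (`classGroupNorm_layer_…`, `isCyclic_aut_layer_layer'`, …):

* §1 transport lemmas along compatible ring isomorphisms: `mk0_not_mem_range_classGroupExtend_of_ringEquiv`, `mk0_sq_eq_one_of_ringEquiv`,
  and `mulEquiv_intAut_mk0_eq_of_unique` (an automorphism fixes the class of the unique prime above `2`);
* §2 `mk0_dyadic_sq_eq_one_layer_restrict` — `c_m² = 1`;
* §2 `dyadicCapitulation_layer_restrict` — for `m ≥ 1`: `ker(Cl(K_m) → Cl(K_{m+1})) ⊆ {1, c_m}` and `c_{m+1} ∉ im(Cl(K_m) → Cl(K_{m+1}))`;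
* §2 `mk0_dyadic_ne_one_layer_restrict` — `c_m ≠ 1` for `m ≥ 2`;
* §3 `classGroupNorm_mk0_dyadic_layer_restrict` — `N_{K_{b+k}/K_b} c_{b+k} = c_b` (`𝔓_{b+k}` is totally ramified over `K_b`, `f = 1`).

These are the inputs of Ferrero's computation that `c_m` is not a square in `Cl(K_m)` for `m ≫ 0` (file
`ImaginaryQuadraticTwoTowerDyadicClassNotSquare`). [Ferrero1980AJM, §3; Kida1979Tohoku, Thm. 1; Washington1997, §13.3]

## References

* B. Ferrero, *The cyclotomic ℤ₂-extension of imaginary quadratic fields*, Amer. J. Math. 102 (1980) 447–459, §3. [Ferrero1980AJM]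
* Y. Kida, *On cyclotomic ℤ₂-extensions of imaginary quadratic fields*, Tohoku Math. J. 31 (1979) 91–96, Thm. 1. [Kida1979Tohoku]
* L. C. Washington, *Introduction to Cyclotomic Fields*, GTM 83, Springer 1997, §13.3. [Washington1997]
* J. Neukirch, *Algebraic Number Theory*, Springer 1999, Ch. III §1 Prop. (1.6). [NeukirchANT1999]
-/

noncomputable section

open NumberField IsDedekindDomain IntermediateField
open scoped nonZeroDivisors

namespace Literature.NumberTheory.IwasawaTheory

open Literature.NumberTheory.EllipticCurves Literature.NumberTheory.EllipticCurves.ZpExtension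
  Literature.NumberTheory.EllipticCurves.CoatesSujatha2005 Literature.NumberTheory.GaloisRepresentations
  Literature.NumberTheory.NumberFields

/-! ## §1 Transport along ring isomorphisms -/

section Transport

variable {M L M' L' : Type} [Field M] [NumberField M] [Field L] [NumberField L] [Algebra M L]
  [Field M'] [NumberField M'] [Field L'] [NumberField L'] [Algebra M' L']

/-- **Transport of «the dyadic class is not extended».**  `gM : M' ≃ M`, `gL : L' ≃ L` compatible ring isomorphisms of the pairs `M' ⊆ L'`, `M ⊆ L`;
if NO prime of `L` containing `2` has its class in the image of `Cl(M) → Cl(L)`, then no prime of `L'` containing `2` has its class in the image of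
`Cl(M') → Cl(L')`. [cite: NeukirchANT1999, Ch. III §1 Prop. (1.6)] -/
theorem mk0_not_mem_range_classGroupExtend_of_ringEquiv (gM : M' ≃+* M) (gL : L' ≃+* L)
    (hcomp : ∀ x : M', gL (algebraMap M' L' x) = algebraMap M L (gM x))
    (hnot : ∀ 𝔓 : HeightOneSpectrum (𝓞 L), (2 : 𝓞 L) ∈ 𝔓.asIdeal →
      ClassGroup.mk0 ⟨𝔓.asIdeal, mem_nonZeroDivisors_of_ne_zero 𝔓.ne_bot⟩ ∉ (classGroupExtend M L).range)
    (𝔓' : HeightOneSpectrum (𝓞 L')) (h2 : (2 : 𝓞 L') ∈ 𝔓'.asIdeal) :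
    ClassGroup.mk0 ⟨𝔓'.asIdeal, mem_nonZeroDivisors_of_ne_zero 𝔓'.ne_bot⟩ ∉ (classGroupExtend M' L').range := by
  classical
  rintro ⟨c', hc'⟩
  obtain ⟨⟨𝔞', h𝔞'⟩, rfl⟩ := ClassGroup.mk0_surjective c'
  have h𝔞'0 : 𝔞' ≠ ⊥ := nonZeroDivisors.ne_zero h𝔞'
  set fM : 𝓞 M' ≃+* 𝓞 M := RingOfIntegers.mapRingEquiv gM with hfM
  set fL : 𝓞 L' ≃+* 𝓞 L := RingOfIntegers.mapRingEquiv gL with hfL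
  have hsq : (algebraMap (𝓞 M) (𝓞 L)).comp (fM : 𝓞 M' →+* 𝓞 M) = (fL : 𝓞 L' →+* 𝓞 L).comp (algebraMap (𝓞 M') (𝓞 L')) := by
    ext x
    change algebraMap M L (gM (x : M')) = gL (algebraMap M' L' (x : M'))
    rw [hcomp]
  -- the image prime `fL 𝔓'` of `L` contains `2`
  haveI := 𝔓'.isMaximal
  have hPmax : (𝔓'.asIdeal.map (fL : 𝓞 L' →+* 𝓞 L)).IsMaximal := by
    rw [Ideal.map_comap_of_equiv]
    exact Ideal.comap_isMaximal_of_surjective _ fL.symm.surjective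
  have hP0 : 𝔓'.asIdeal.map (fL : 𝓞 L' →+* 𝓞 L) ≠ ⊥ := fun h0 =>
    𝔓'.ne_bot ((Ideal.map_eq_bot_iff_of_injective (f := (fL : 𝓞 L' →+* 𝓞 L)) fL.injective).mp h0)
  set P : HeightOneSpectrum (𝓞 L) := ⟨_, hPmax.isPrime, hP0⟩ with hPdef
  have h2P : (2 : 𝓞 L) ∈ P.asIdeal := by
    change (2 : 𝓞 L) ∈ 𝔓'.asIdeal.map (fL : 𝓞 L' →+* 𝓞 L)
    have := Ideal.mem_map_of_mem (fL : 𝓞 L' →+* 𝓞 L) h2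
    rwa [map_ofNat] at this
  apply hnot P h2P
  -- the transported ideal `fM 𝔞'`
  set 𝔞 : Ideal (𝓞 M) := 𝔞'.map (fM : 𝓞 M' →+* 𝓞 M) with h𝔞
  have h𝔞0 : 𝔞 ≠ ⊥ := fun h0 =>
    h𝔞'0 ((Ideal.map_eq_bot_iff_of_injective (f := (fM : 𝓞 M' →+* 𝓞 M)) fM.injective).mp h0)
  refine ⟨ClassGroup.mk0 ⟨𝔞, mem_nonZeroDivisors_of_ne_zero h𝔞0⟩, ?_⟩
  rw [classGroupExtend_mk0, ClassGroup.mk0_eq_mk0_iff] at hc' ⊢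
  obtain ⟨x, y, hx, hy, hxy⟩ := hc'
  refine ⟨fL x, fL y, (map_ne_zero_iff _ fL.injective).mpr hx, (map_ne_zero_iff _ fL.injective).mpr hy, ?_⟩
  have := congrArg (Ideal.map (fL : 𝓞 L' →+* 𝓞 L)) hxy
  rw [Ideal.map_mul, Ideal.map_mul, Ideal.map_span, Set.image_singleton, Ideal.map_span, Set.image_singleton] at this
  change Ideal.span {fL x} * (𝔞'.map (algebraMap (𝓞 M') (𝓞 L'))).map (fL : 𝓞 L' →+* 𝓞 L) =
    Ideal.span {fL y} * 𝔓'.asIdeal.map (fL : 𝓞 L' →+* 𝓞 L) at this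
  rw [Ideal.map_map, ← hsq, ← Ideal.map_map] at this
  exact this

/-- **Transport of «the dyadic class has order dividing `2`».**  `gL : L' ≃ L`; if every prime of `L` containing `2` has `[𝔓]² = 1`, then so does
every prime of `L'` containing `2` (`𝔓'² = gL⁻¹((gL 𝔓')²)` is principal). [cite: NeukirchANT1999, Ch. III §1 Prop. (1.6)] -/
theorem mk0_sq_eq_one_of_ringEquiv (gL : L' ≃+* L)
    (hsq : ∀ 𝔓 : HeightOneSpectrum (𝓞 L), (2 : 𝓞 L) ∈ 𝔓.asIdeal →
      ClassGroup.mk0 ⟨𝔓.asIdeal, mem_nonZeroDivisors_of_ne_zero 𝔓.ne_bot⟩ ^ 2 = 1)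
    (𝔓' : HeightOneSpectrum (𝓞 L')) (h2 : (2 : 𝓞 L') ∈ 𝔓'.asIdeal) :
    ClassGroup.mk0 ⟨𝔓'.asIdeal, mem_nonZeroDivisors_of_ne_zero 𝔓'.ne_bot⟩ ^ 2 = 1 := by
  classical
  set fL : 𝓞 L' ≃+* 𝓞 L := RingOfIntegers.mapRingEquiv gL with hfL
  haveI := 𝔓'.isMaximal
  have hPmax : (𝔓'.asIdeal.map (fL : 𝓞 L' →+* 𝓞 L)).IsMaximal := by
    rw [Ideal.map_comap_of_equiv]
    exact Ideal.comap_isMaximal_of_surjective _ fL.symm.surjective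
  have hP0 : 𝔓'.asIdeal.map (fL : 𝓞 L' →+* 𝓞 L) ≠ ⊥ := fun h0 =>
    𝔓'.ne_bot ((Ideal.map_eq_bot_iff_of_injective (f := (fL : 𝓞 L' →+* 𝓞 L)) fL.injective).mp h0)
  set P : HeightOneSpectrum (𝓞 L) := ⟨_, hPmax.isPrime, hP0⟩ with hPdef
  have h2P : (2 : 𝓞 L) ∈ P.asIdeal := by
    change (2 : 𝓞 L) ∈ 𝔓'.asIdeal.map (fL : 𝓞 L' →+* 𝓞 L)
    have := Ideal.mem_map_of_mem (fL : 𝓞 L' →+* 𝓞 L) h2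
    rwa [map_ofNat] at this
  have h1 := hsq P h2P
  rw [← map_pow, ClassGroup.mk0_eq_one_iff, SubmonoidClass.mk_pow] at h1 ⊢
  obtain ⟨t, ht⟩ := h1
  have ht' : P.asIdeal ^ 2 = Ideal.span {t} := ht
  have hback : 𝔓'.asIdeal ^ 2 = (P.asIdeal ^ 2).map (fL.symm : 𝓞 L →+* 𝓞 L') := by
    rw [Ideal.map_pow]
    congr 1
    change 𝔓'.asIdeal = (𝔓'.asIdeal.map (fL : 𝓞 L' →+* 𝓞 L)).map (fL.symm : 𝓞 L →+* 𝓞 L')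
    rw [Ideal.map_of_equiv]
  change (𝔓'.asIdeal ^ 2).IsPrincipal
  rw [hback, ht', Ideal.map_span, Set.image_singleton]
  exact ⟨⟨_, rfl⟩⟩

omit [NumberField M] in
/-- **An automorphism fixes the class of the unique prime above `2`.**  `σ ∈ Aut(L/M)`, `𝔓` the only prime of `L` containing `2` ⟹ `σ[𝔓] = [𝔓]`
(`σ𝔓` is again a prime containing `2`). [cite: Washington1997, §13.3 (proof of Lemma 13.15: the ramified primes are fixed)] -/
theorem mulEquiv_intAut_mk0_eq_of_unique (σ : L ≃ₐ[M] L) (𝔓 : HeightOneSpectrum (𝓞 L)) (h2 : (2 : 𝓞 L) ∈ 𝔓.asIdeal)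
    (huniq : ∀ Q : HeightOneSpectrum (𝓞 L), (2 : 𝓞 L) ∈ Q.asIdeal → Q = 𝔓) :
    ClassGroup.mulEquiv (AmbiguousClass.intAut σ) (ClassGroup.mk0 ⟨𝔓.asIdeal, mem_nonZeroDivisors_of_ne_zero 𝔓.ne_bot⟩) =
      ClassGroup.mk0 ⟨𝔓.asIdeal, mem_nonZeroDivisors_of_ne_zero 𝔓.ne_bot⟩ := by
  classical
  rw [AmbiguousClass.mulEquiv_mk0]
  congr 1
  apply Subtype.ext
  change 𝔓.asIdeal.map (AmbiguousClass.intAut σ : 𝓞 L →+* 𝓞 L) = 𝔓.asIdeal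
  set f : 𝓞 L ≃+* 𝓞 L := AmbiguousClass.intAut σ with hf
  haveI := 𝔓.isMaximal
  have hPmax : (𝔓.asIdeal.map (f : 𝓞 L →+* 𝓞 L)).IsMaximal := by
    rw [Ideal.map_comap_of_equiv]
    exact Ideal.comap_isMaximal_of_surjective _ f.symm.surjective
  have hP0 : 𝔓.asIdeal.map (f : 𝓞 L →+* 𝓞 L) ≠ ⊥ := fun h0 =>
    𝔓.ne_bot ((Ideal.map_eq_bot_iff_of_injective (f := (f : 𝓞 L →+* 𝓞 L)) f.injective).mp h0)
  set P : HeightOneSpectrum (𝓞 L) := ⟨_, hPmax.isPrime, hP0⟩ with hPdef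
  have h2P : (2 : 𝓞 L) ∈ P.asIdeal := by
    change (2 : 𝓞 L) ∈ 𝔓.asIdeal.map (f : 𝓞 L →+* 𝓞 L)
    have := Ideal.mem_map_of_mem (f : 𝓞 L →+* 𝓞 L) h2
    rwa [map_ofNat] at this
  exact congrArg HeightOneSpectrum.asIdeal (huniq P h2P)

end Transport

/-! ## §2 The layers `K_m` of `κ₀ = (ℚ_∞)|_K`, `K ∋ √−d`, `d ≡ 1 (mod 4)` -/

section Tower

variable (K : Type) [Field K] [NumberField K]

/-- `e(P | F) = [L : F]` in a Galois extension of number fields ⟹ `f(P | F) = 1` (`g·e·f = [L : F]`, Mathlib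
`Ideal.ncard_primesOver_mul_ramificationIdxIn_mul_inertiaDegIn`) (auxiliary). [folklore] -/
private theorem inertiaDeg_eq_one_of_ramificationIdx_eq_finrank (F L : Type) [Field F] [NumberField F] [Field L] [NumberField L]
    [Algebra F L] [IsGalois F L] (P : Ideal (𝓞 L)) [P.IsMaximal] (hP : P.ramificationIdx (𝓞 F) = Module.finrank F L) :
    P.inertiaDeg (𝓞 F) = 1 := by
  haveI : (P.under (𝓞 F)).IsMaximal := Ideal.IsMaximal.under (𝓞 F) P
  have hid := Ideal.ncard_primesOver_mul_ramificationIdxIn_mul_inertiaDegIn (P.under (𝓞 F)) (𝓞 L) (L ≃ₐ[F] L)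
  rw [IsGalois.card_aut_eq_finrank, Ideal.ramificationIdxIn_eq_ramificationIdx (P.under (𝓞 F)) P (L ≃ₐ[F] L),
    Ideal.inertiaDegIn_eq_inertiaDeg (P.under (𝓞 F)) P (L ≃ₐ[F] L), hP] at hid
  have hpos : 0 < Module.finrank F L := Module.finrank_pos
  have h1 : ((P.under (𝓞 F)).primesOver (𝓞 L)).ncard * P.inertiaDeg (𝓞 F) = 1 := by
    apply Nat.eq_of_mul_eq_mul_right hpos
    rw [one_mul]
    calc ((P.under (𝓞 F)).primesOver (𝓞 L)).ncard * P.inertiaDeg (𝓞 F) * Module.finrank F L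
        = ((P.under (𝓞 F)).primesOver (𝓞 L)).ncard * (Module.finrank F L * P.inertiaDeg (𝓞 F)) := by ring
      _ = Module.finrank F L := hid
  exact Nat.eq_one_of_mul_eq_one_left h1

/-- **`[𝔓_m]² = 1`** for every prime `𝔓_m ∋ 2` of the layer `K_m` of `κ₀ = (ℚ_∞)|_K` (`K ∋ √−d`, `d ≡ 1 (mod 4)`): in the model `X_m = e(K)·ℚ_m`
(a CM field with `h(X_m⁺)` odd) `𝔓² = 𝔭⁺𝓞` with `𝔭⁺` principal (tree `dyadic_of_isCMField`), transported along `X_m ≅ K_m`.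
[cite: Ferrero1980AJM, §3] [cite: Washington1997, §13.3] -/
theorem mk0_dyadic_sq_eq_one_layer_restrict (hK2 : Module.finrank ℚ K = 2) {d : ℕ} (hd4 : d % 4 = 1)
    (hη : ∃ η : K, η ^ 2 = -((d : ℕ) : K))
    (h : Function.Surjective ((CyclotomicZp.zpExtension 2).toContinuousMonoidHom.comp (absGaloisRestrict ℚ K))) (m : ℕ)
    [NumberField ↥(((CyclotomicZp.zpExtension 2).restrict K h).layer m)] :
    ∀ 𝔓 : HeightOneSpectrum (𝓞 ↥(((CyclotomicZp.zpExtension 2).restrict K h).layer m)), (2 : 𝓞 ↥(((CyclotomicZp.zpExtension 2).restrict K h).layer m)) ∈ 𝔓.asIdeal →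
      ClassGroup.mk0 ⟨𝔓.asIdeal, mem_nonZeroDivisors_of_ne_zero 𝔓.ne_bot⟩ ^ 2 = 1 := by
  classical
  intro 𝔓 h2
  haveI : Fact (Nat.Prime 2) := ⟨Nat.prime_two⟩
  have hcyc : (CyclotomicZp.zpExtension 2).IsCyclotomic := CyclotomicZp.isCyclotomic_zpExtension 2
  have hIQ := isImaginaryQuadratic_of_sq_eq_neg K hK2 (by omega) hη
  haveI : NumberField ↥((absEmbedding ℚ K).fieldRange ⊔ (CyclotomicZp.zpExtension 2).layer m) :=
    numberField_fieldRange_sup_layer (CyclotomicZp.zpExtension 2) K (absEmbedding ℚ K) m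
  obtain ⟨hCM, hdeg, hrest⟩ := isCMField_fieldRange_sup_layer hcyc K hIQ (absEmbedding ℚ K) m
  haveI := hCM
  obtain ⟨hodd, -, -, -⟩ := hrest
  obtain ⟨𝔓X, h2X, heX, huniqX⟩ := exists_dyadic_prime_fieldRange_sup_layer hcyc K hK2 hd4 hη m
  have hsqX : ∀ Q : HeightOneSpectrum (𝓞 ↥((absEmbedding ℚ K).fieldRange ⊔ (CyclotomicZp.zpExtension 2).layer m)),
      (2 : 𝓞 ↥((absEmbedding ℚ K).fieldRange ⊔ (CyclotomicZp.zpExtension 2).layer m)) ∈ Q.asIdeal →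
      ClassGroup.mk0 ⟨Q.asIdeal, mem_nonZeroDivisors_of_ne_zero Q.ne_bot⟩ ^ 2 = 1 := by
    intro Q hQ
    obtain rfl := huniqX Q hQ
    have key := @dyadic_of_isCMField _ _ (by assumption) hCM hodd m hdeg
    exact (key Q hQ heX huniqX).2
  obtain ⟨f, -⟩ := exists_ringEquiv_fieldRange_sup_layer_apply K h m
  exact mk0_sq_eq_one_of_ringEquiv f.symm hsqX 𝔓 h2

/-- **The dyadic prime of `K_m` is unique** (HeightOneSpectrum form of tree `exists_dyadic_prime_layer`): there is a prime `𝔓_m ∋ 2` of `K_m` with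
`e(𝔓_m ∣ 𝓞 K) = 2^m`, and every prime of `K_m` containing `2` is `𝔓_m`. [cite: Washington1997, §13.1] [cite: Ferrero1980AJM, §3] -/
theorem exists_unique_dyadic_layer_restrict (hK2 : Module.finrank ℚ K = 2) {d : ℕ} (hd4 : d % 4 = 1)
    (hη : ∃ η : K, η ^ 2 = -((d : ℕ) : K))
    (h : Function.Surjective ((CyclotomicZp.zpExtension 2).toContinuousMonoidHom.comp (absGaloisRestrict ℚ K))) (m : ℕ)
    [NumberField ↥(((CyclotomicZp.zpExtension 2).restrict K h).layer m)] :
    ∃ 𝔓 : HeightOneSpectrum (𝓞 ↥(((CyclotomicZp.zpExtension 2).restrict K h).layer m)),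
      (2 : 𝓞 ↥(((CyclotomicZp.zpExtension 2).restrict K h).layer m)) ∈ 𝔓.asIdeal ∧ 𝔓.asIdeal.ramificationIdx (𝓞 K) = 2 ^ m ∧
      ∀ Q : HeightOneSpectrum (𝓞 ↥(((CyclotomicZp.zpExtension 2).restrict K h).layer m)), (2 : 𝓞 ↥(((CyclotomicZp.zpExtension 2).restrict K h).layer m)) ∈ Q.asIdeal → Q = 𝔓 := by
  haveI : Fact (Nat.Prime 2) := ⟨Nat.prime_two⟩
  have hcyc : (CyclotomicZp.zpExtension 2).IsCyclotomic := CyclotomicZp.isCyclotomic_zpExtension 2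
  have hκ₀c : ((CyclotomicZp.zpExtension 2).restrict K h).IsCyclotomic := isCyclotomic_restrict (CyclotomicZp.zpExtension 2) hcyc K h
  obtain ⟨P, hPmax, heK, -, h2P, huniqP⟩ := exists_dyadic_prime_layer K hK2 hd4 hη ((CyclotomicZp.zpExtension 2).restrict K h) hκ₀c m
  haveI := hPmax
  have hP0 : P ≠ ⊥ := Ring.ne_bot_of_isMaximal_of_not_isField hPmax (RingOfIntegers.not_isField _)
  refine ⟨⟨P, hPmax.isPrime, hP0⟩, h2P, heK, fun Q hQ => ?_⟩
  haveI := Q.isMaximal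
  exact HeightOneSpectrum.ext (huniqP Q.asIdeal hQ)

/-- ★ **Capitulation kernel and non-extended dyadic class, for the layers `K_m ⊆ K_{m+1}` (`m ≥ 1`) of `κ₀ = (ℚ_∞)|_K`** (`K ∋ √−d`, `d ≡ 1 (mod 4)`
squarefree, `d ≠ 1`): (i) every class of `K_m` capitulating in `K_{m+1}` is `1` or `[𝔓_m]`; (ii) `[𝔓_{m+1}]` is not the extension of a class of `K_m`.
Transported from the model `X_m ⊆ X_{m+1}` (tree `dyadicCapitulation_fieldRange_sup_layer`). [cite: Ferrero1980AJM, §3] [cite: Kida1979Tohoku, Thm. 1]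
[cite: Washington1997, §13.3] -/
theorem dyadicCapitulation_layer_restrict (hK2 : Module.finrank ℚ K = 2) {d : ℕ} (hsf : Squarefree d) (hd4 : d % 4 = 1) (hd1 : d ≠ 1)
    (hη : ∃ η : K, η ^ 2 = -((d : ℕ) : K))
    (h : Function.Surjective ((CyclotomicZp.zpExtension 2).toContinuousMonoidHom.comp (absGaloisRestrict ℚ K))) (m : ℕ) (hm : 1 ≤ m)
    [NumberField ↥(((CyclotomicZp.zpExtension 2).restrict K h).layer m)] [NumberField ↥(((CyclotomicZp.zpExtension 2).restrict K h).layer (m + 1))] :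
    letI : Algebra ↥(((CyclotomicZp.zpExtension 2).restrict K h).layer m) ↥(((CyclotomicZp.zpExtension 2).restrict K h).layer (m + 1)) :=
      (IntermediateField.inclusion (((CyclotomicZp.zpExtension 2).restrict K h).layer_mono (Nat.le_succ m))).toRingHom.toAlgebra
    (∀ 𝔓M : HeightOneSpectrum (𝓞 ↥(((CyclotomicZp.zpExtension 2).restrict K h).layer m)), (2 : 𝓞 ↥(((CyclotomicZp.zpExtension 2).restrict K h).layer m)) ∈ 𝔓M.asIdeal →
        ∀ c, classGroupExtend ↥(((CyclotomicZp.zpExtension 2).restrict K h).layer m) ↥(((CyclotomicZp.zpExtension 2).restrict K h).layer (m + 1)) c = 1 →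
          c = 1 ∨ c = ClassGroup.mk0 ⟨𝔓M.asIdeal, mem_nonZeroDivisors_of_ne_zero 𝔓M.ne_bot⟩) ∧
      (∀ 𝔓L : HeightOneSpectrum (𝓞 ↥(((CyclotomicZp.zpExtension 2).restrict K h).layer (m + 1))), (2 : 𝓞 ↥(((CyclotomicZp.zpExtension 2).restrict K h).layer (m + 1))) ∈ 𝔓L.asIdeal →
        ClassGroup.mk0 ⟨𝔓L.asIdeal, mem_nonZeroDivisors_of_ne_zero 𝔓L.ne_bot⟩ ∉
          (classGroupExtend ↥(((CyclotomicZp.zpExtension 2).restrict K h).layer m) ↥(((CyclotomicZp.zpExtension 2).restrict K h).layer (m + 1))).range) := by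
  obtain ⟨n, rfl⟩ : ∃ n, m = n + 1 := ⟨m - 1, by omega⟩
  classical
  haveI : Fact (Nat.Prime 2) := ⟨Nat.prime_two⟩
  have hcyc : (CyclotomicZp.zpExtension 2).IsCyclotomic := CyclotomicZp.isCyclotomic_zpExtension 2
  letI : Algebra ↥(((CyclotomicZp.zpExtension 2).restrict K h).layer (n + 1)) ↥(((CyclotomicZp.zpExtension 2).restrict K h).layer (n + 1 + 1)) :=
    (IntermediateField.inclusion (((CyclotomicZp.zpExtension 2).restrict K h).layer_mono (Nat.le_succ (n + 1)))).toRingHom.toAlgebra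
  -- the model pair `X_{n+1} ⊆ X_{n+2}` and the isomorphisms
  haveI : NumberField ↥((absEmbedding ℚ K).fieldRange ⊔ (CyclotomicZp.zpExtension 2).layer (n + 1)) :=
    numberField_fieldRange_sup_layer (CyclotomicZp.zpExtension 2) K (absEmbedding ℚ K) (n + 1)
  haveI : NumberField ↥((absEmbedding ℚ K).fieldRange ⊔ (CyclotomicZp.zpExtension 2).layer (n + 2)) :=
    numberField_fieldRange_sup_layer (CyclotomicZp.zpExtension 2) K (absEmbedding ℚ K) (n + 2)
  letI : Algebra ↥((absEmbedding ℚ K).fieldRange ⊔ (CyclotomicZp.zpExtension 2).layer (n + 1))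
      ↥((absEmbedding ℚ K).fieldRange ⊔ (CyclotomicZp.zpExtension 2).layer (n + 2)) :=
    (IntermediateField.inclusion (sup_le_sup_left ((CyclotomicZp.zpExtension 2).layer_mono (by omega)) _)).toRingHom.toAlgebra
  obtain ⟨eM, eL, hcomp⟩ := exists_ringEquiv_fieldRange_sup_layer_pair K h n
  obtain ⟨𝔓M, h2M, -, huniqM⟩ := exists_dyadic_prime_fieldRange_sup_layer hcyc K hK2 hd4 hη (n + 1)
  obtain ⟨𝔓L, h2L, -, huniqL⟩ := exists_dyadic_prime_fieldRange_sup_layer hcyc K hK2 hd4 hη (n + 2)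
  obtain ⟨hker, hnot, -⟩ := dyadicCapitulation_fieldRange_sup_layer hcyc K hK2 hsf hd4 hd1 hη n 𝔓M h2M 𝔓L h2L
  have hnot' : ∀ Q : HeightOneSpectrum (𝓞 ↥((absEmbedding ℚ K).fieldRange ⊔ (CyclotomicZp.zpExtension 2).layer (n + 2))),
      (2 : 𝓞 ↥((absEmbedding ℚ K).fieldRange ⊔ (CyclotomicZp.zpExtension 2).layer (n + 2))) ∈ Q.asIdeal →
      ClassGroup.mk0 ⟨Q.asIdeal, mem_nonZeroDivisors_of_ne_zero Q.ne_bot⟩ ∉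
        (classGroupExtend ↥((absEmbedding ℚ K).fieldRange ⊔ (CyclotomicZp.zpExtension 2).layer (n + 1))
          ↥((absEmbedding ℚ K).fieldRange ⊔ (CyclotomicZp.zpExtension 2).layer (n + 2))).range := by
    intro Q hQ
    obtain rfl := huniqL Q hQ
    exact hnot
  have hcomp' : ∀ x', eL.symm (algebraMap ↥(((CyclotomicZp.zpExtension 2).restrict K h).layer (n + 1)) ↥(((CyclotomicZp.zpExtension 2).restrict K h).layer (n + 1 + 1)) x') =
      algebraMap ↥((absEmbedding ℚ K).fieldRange ⊔ (CyclotomicZp.zpExtension 2).layer (n + 1))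
        ↥((absEmbedding ℚ K).fieldRange ⊔ (CyclotomicZp.zpExtension 2).layer (n + 2)) (eM.symm x') := by
    intro x'
    apply eL.injective
    rw [RingEquiv.apply_symm_apply, hcomp, RingEquiv.apply_symm_apply]
  -- uniqueness of the dyadic prime of `K_{n+1}`
  obtain ⟨𝔓', h2', -, huniq'⟩ := exists_unique_dyadic_layer_restrict K hK2 hd4 hη h (n + 1)
  refine ⟨fun 𝔓M' h2M' c hc => ?_, fun 𝔓L' h2L' => ?_⟩
  · obtain rfl := huniq' 𝔓M' h2M'
    exact eq_one_or_eq_mk0_of_classGroupExtend_eq_one_of_ringEquiv eM eL hcomp 𝔓M h2M hker 𝔓M' huniq' hc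
  · exact mk0_not_mem_range_classGroupExtend_of_ringEquiv eM.symm eL.symm hcomp' hnot' 𝔓L' h2L'

/-- **`[𝔓_m] ≠ 1` for `m ≥ 2`**: `[𝔓_m]` is not even the extension of a class of `K_{m−1}` (`dyadicCapitulation_layer_restrict` (ii)).
[cite: Ferrero1980AJM, §3] [cite: Kida1979Tohoku, Thm. 1] -/
theorem mk0_dyadic_ne_one_layer_restrict (hK2 : Module.finrank ℚ K = 2) {d : ℕ} (hsf : Squarefree d) (hd4 : d % 4 = 1) (hd1 : d ≠ 1)
    (hη : ∃ η : K, η ^ 2 = -((d : ℕ) : K))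
    (h : Function.Surjective ((CyclotomicZp.zpExtension 2).toContinuousMonoidHom.comp (absGaloisRestrict ℚ K))) (m : ℕ) (hm : 2 ≤ m)
    [NumberField ↥(((CyclotomicZp.zpExtension 2).restrict K h).layer m)] :
    ∀ 𝔓 : HeightOneSpectrum (𝓞 ↥(((CyclotomicZp.zpExtension 2).restrict K h).layer m)), (2 : 𝓞 ↥(((CyclotomicZp.zpExtension 2).restrict K h).layer m)) ∈ 𝔓.asIdeal →
      ClassGroup.mk0 ⟨𝔓.asIdeal, mem_nonZeroDivisors_of_ne_zero 𝔓.ne_bot⟩ ≠ 1 := by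
  obtain ⟨n, rfl⟩ : ∃ n, m = n + 1 + 1 := ⟨m - 2, by omega⟩
  intro 𝔓 h2 h1
  haveI : Fact (Nat.Prime 2) := ⟨Nat.prime_two⟩
  haveI : FiniteDimensional K ↥(((CyclotomicZp.zpExtension 2).restrict K h).layer (n + 1)) := ((CyclotomicZp.zpExtension 2).restrict K h).finiteDimensional_layer_holds _
  haveI : NumberField ↥(((CyclotomicZp.zpExtension 2).restrict K h).layer (n + 1)) := NumberField.of_module_finite K _
  obtain ⟨-, hnot⟩ := dyadicCapitulation_layer_restrict K hK2 hsf hd4 hd1 hη h (n + 1) (by omega)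
  exact hnot 𝔓 h2 ⟨1, by rw [map_one, h1]⟩

/-! ## §3 The norm of the dyadic class -/

/-- ★ **`N_{K_{b+k}/K_b}[𝔓_{b+k}] = [𝔓_b]`**: the dyadic prime `𝔓_{b+k}` of `K_{b+k}` is totally ramified over `K` (`e = 2^{b+k} = [K_{b+k} : K]`), hence over `K_b`
(tree `ramificationIdx_eq_finrank_top`), so its residue degree over `𝔓_b = 𝔓_{b+k} ∩ K_b` is `1` (`g·e·f = [K_{b+k} : K_b]`) and `N[𝔓_{b+k}] = [𝔓_b]^f = [𝔓_b]`
(tree `classGroupNorm_mk0_heightOneSpectrum`). [cite: Washington1997, §13.3 (before Lemma 13.15)] [cite: Ferrero1980AJM, §3] -/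
theorem classGroupNorm_mk0_dyadic_layer_restrict (hK2 : Module.finrank ℚ K = 2) {d : ℕ} (hd4 : d % 4 = 1)
    (hη : ∃ η : K, η ^ 2 = -((d : ℕ) : K))
    (h : Function.Surjective ((CyclotomicZp.zpExtension 2).toContinuousMonoidHom.comp (absGaloisRestrict ℚ K))) (b k : ℕ)
    [NumberField ↥(((CyclotomicZp.zpExtension 2).restrict K h).layer b)] [NumberField ↥(((CyclotomicZp.zpExtension 2).restrict K h).layer (b + k))] :
    letI : Algebra ↥(((CyclotomicZp.zpExtension 2).restrict K h).layer b) ↥(((CyclotomicZp.zpExtension 2).restrict K h).layer (b + k)) :=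
      (IntermediateField.inclusion (((CyclotomicZp.zpExtension 2).restrict K h).layer_mono (Nat.le_add_right b k))).toRingHom.toAlgebra
    ∀ 𝔓b : HeightOneSpectrum (𝓞 ↥(((CyclotomicZp.zpExtension 2).restrict K h).layer b)), (2 : 𝓞 ↥(((CyclotomicZp.zpExtension 2).restrict K h).layer b)) ∈ 𝔓b.asIdeal →
    ∀ 𝔓 : HeightOneSpectrum (𝓞 ↥(((CyclotomicZp.zpExtension 2).restrict K h).layer (b + k))), (2 : 𝓞 ↥(((CyclotomicZp.zpExtension 2).restrict K h).layer (b + k))) ∈ 𝔓.asIdeal →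
      classGroupNorm ↥(((CyclotomicZp.zpExtension 2).restrict K h).layer b) ↥(((CyclotomicZp.zpExtension 2).restrict K h).layer (b + k)) (ClassGroup.mk0 ⟨𝔓.asIdeal, mem_nonZeroDivisors_of_ne_zero 𝔓.ne_bot⟩) =
        ClassGroup.mk0 ⟨𝔓b.asIdeal, mem_nonZeroDivisors_of_ne_zero 𝔓b.ne_bot⟩ := by
  classical
  haveI : Fact (Nat.Prime 2) := ⟨Nat.prime_two⟩
  letI : Algebra ↥(((CyclotomicZp.zpExtension 2).restrict K h).layer b) ↥(((CyclotomicZp.zpExtension 2).restrict K h).layer (b + k)) :=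
    (IntermediateField.inclusion (((CyclotomicZp.zpExtension 2).restrict K h).layer_mono (Nat.le_add_right b k))).toRingHom.toAlgebra
  intro 𝔓b h2b 𝔓 h2
  haveI : IsScalarTower K ↥(((CyclotomicZp.zpExtension 2).restrict K h).layer b) ↥(((CyclotomicZp.zpExtension 2).restrict K h).layer (b + k)) :=
    IsScalarTower.of_algebraMap_eq fun x => ((IntermediateField.inclusion (((CyclotomicZp.zpExtension 2).restrict K h).layer_mono (Nat.le_add_right b k))).commutes x).symm
  haveI : FiniteDimensional K ↥(((CyclotomicZp.zpExtension 2).restrict K h).layer b) := ((CyclotomicZp.zpExtension 2).restrict K h).finiteDimensional_layer_holds _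
  haveI : FiniteDimensional K ↥(((CyclotomicZp.zpExtension 2).restrict K h).layer (b + k)) := ((CyclotomicZp.zpExtension 2).restrict K h).finiteDimensional_layer_holds _
  haveI : FiniteDimensional ↥(((CyclotomicZp.zpExtension 2).restrict K h).layer b) ↥(((CyclotomicZp.zpExtension 2).restrict K h).layer (b + k)) := Module.Finite.of_restrictScalars_finite K _ _
  haveI : IsGalois K ↥(((CyclotomicZp.zpExtension 2).restrict K h).layer b) := ((CyclotomicZp.zpExtension 2).restrict K h).isGalois_layer_holds _
  haveI : IsGalois K ↥(((CyclotomicZp.zpExtension 2).restrict K h).layer (b + k)) := ((CyclotomicZp.zpExtension 2).restrict K h).isGalois_layer_holds _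
  haveI : IsGalois ↥(((CyclotomicZp.zpExtension 2).restrict K h).layer b) ↥(((CyclotomicZp.zpExtension 2).restrict K h).layer (b + k)) := isGalois_layer_layer ((CyclotomicZp.zpExtension 2).restrict K h)
  -- the dyadic primes, `𝔓 ∩ K_b = 𝔓b`
  obtain ⟨𝔓', h2', he', huniq'⟩ := exists_unique_dyadic_layer_restrict K hK2 hd4 hη h (b + k)
  obtain ⟨𝔓b', h2b', -, huniqb'⟩ := exists_unique_dyadic_layer_restrict K hK2 hd4 hη h b
  obtain rfl := huniq' 𝔓 h2
  obtain rfl := huniqb' 𝔓b h2b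
  haveI := 𝔓.isMaximal
  haveI := 𝔓b.isMaximal
  have hunder : 𝔓.under (𝓞 ↥(((CyclotomicZp.zpExtension 2).restrict K h).layer b)) = 𝔓b := by
    apply huniqb'
    rw [HeightOneSpectrum.under_asIdeal, Ideal.under_def, Ideal.mem_comap, map_ofNat]
    exact h2
  haveI : 𝔓.asIdeal.LiesOver 𝔓b.asIdeal := ⟨congrArg HeightOneSpectrum.asIdeal hunder.symm⟩
  -- `e(𝔓 | K_b) = [K_{b+k} : K_b]`, hence `f(𝔓 | 𝔓b) = 1`
  have heK : 𝔓.asIdeal.ramificationIdx (𝓞 K) = Module.finrank K ↥(((CyclotomicZp.zpExtension 2).restrict K h).layer (b + k)) := by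
    rw [he', ((CyclotomicZp.zpExtension 2).restrict K h).finrank_layer_holds]
  have heF : 𝔓.asIdeal.ramificationIdx (𝓞 ↥(((CyclotomicZp.zpExtension 2).restrict K h).layer b)) = Module.finrank ↥(((CyclotomicZp.zpExtension 2).restrict K h).layer b) ↥(((CyclotomicZp.zpExtension 2).restrict K h).layer (b + k)) :=
    ClassGroupNormKernel.ramificationIdx_eq_finrank_top (B := K) 𝔓.asIdeal heK
  have hf : 𝔓.asIdeal.inertiaDeg (𝓞 ↥(((CyclotomicZp.zpExtension 2).restrict K h).layer b)) = 1 :=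
    inertiaDeg_eq_one_of_ramificationIdx_eq_finrank ↥(((CyclotomicZp.zpExtension 2).restrict K h).layer b) ↥(((CyclotomicZp.zpExtension 2).restrict K h).layer (b + k)) 𝔓.asIdeal heF
  rw [classGroupNorm_mk0_heightOneSpectrum, hf, pow_one]
  congr 1
  exact Subtype.ext (congrArg HeightOneSpectrum.asIdeal hunder)

end Tower

end Literature.NumberTheory.IwasawaTheory

end
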